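import Literature.MathematicalPhysics.QuantumFieldTheory.Balaban1983to89.BlockAveragingTwoLevel

/-!
# RUNG (B)+1 BOOKKEEPING: THE LEVEL IDENTIFICATION BETWEEN TWO OF BAŁABAN'S RUNS — level `j'` of the `ε_{K'} = L^{-K'}` torus
# read as level `j` of the `ε_K = L^{-K}` torus when `K' − K = j' − j` — and its KERNEL-PROVED compatibility with the walks,
# holonomies, unit-level loop representatives and Haar measures of `T4Continuum`, and with Bałaban's block averagings (0.4)
# (`BlockAveraging.blockAvg ℰ`) and (0.12) (`BlockAveragingTwoLevel.blockAvg₂ 𝓜 ℰ`) at every pair of matching levels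
# (cell `pub-balaban`, scoping sub-cell `t4`, unit `b2b-balaban-t4-lean` gen 15, journal row T4-T.L-RUNLADDER*; LOW LEAF:
# imports `BlockAveragingTwoLevel` only; ADDITIVE — no existing module is modified)

HONEST FRAMING.  Rung (B)+1 = the `ε → 0` limit of the joint expectations of unit-scale averaged gauge-invariant loop variables
on ONE four-torus, UNDER (B) = [Balaban1989LargeFieldII] Thm 1 and a β-function hypothesis carried inside every target of
`T4Continuum` (never discharged).  NOT infinite volume, NOT a mass gap, NOT the Clay problem, NOT summit progress.  This file is
ELEMENTARY LATTICE BOOKKEEPING about the tree's own typed objects: every theorem is a finite combinatorial identity (or its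
push-forward under the product Haar measure) and is tagged [folklore]; the `[cite:]` tags below only LOCATE the printed formula a
definition transcribes ((0.1) p. 251, (0.4) p. 253, (0.11) p. 253, (0.12) p. 254 of [Balaban1987RG1]), all of them quoted verbatim
in certified headers already in the tree (`Setup`, `T4Continuum` v5 — "This torus determines a sequence of tori denoted by
T^{(k)}_{L^k ε}" —, `BlockAveraging` v3, `BlockAveragingTwoLevel`).  CITATION HEADER (lean-in-tree rule 2026-08-18): NO sentence of
Bałaban's series is newly quoted here and NO printed estimate, bound or convergence statement is asserted or used.

## Why (the interface question (Q-av) of the two-run lanes)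

The cell's data type `T4Continuum.FiniteEpsData F G` records the averaging operations `D.av K j : Averaging (F.P K) j G` of the
`K`-th run FREELY, level by level and run by run; the sites of level `j` of the `K`-th torus are the type
`Site (F.P K) j = Fin 4 → ZMod (2·L^{m+K−j})` (`Setup.Params.sitesPerDir`, [Balaban1987RG1] (0.1) p. 251 with `ε ↦ L^j ε`).  In the
paper the tori `T^{(j)}_{L^j ε}` of the run at spacing `ε = L^{-K}` and `T^{(j')}_{L^{j'} ε'}` of the run at `ε' = L^{-K'}` with
`L^j ε = L^{j'} ε'`, i.e. `K' − K = j' − j`, are ONE lattice (same spacing, same torus), and ONE block-averaging formula acts on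
both; in the tree they are two types with EQUAL MODULI `2·L^{m+K−j} = 2·L^{m+K'−j'}` and the identity of the paper becomes the
ring isomorphism `ZMod.ringEquivCongr` on coordinates (the device of `T4Continuum.siteEquiv` / `toLevel`, there between the unit
lattices `(F.P 0, 0)` and `(F.P K, K)`).  Two lanes of the cell ask for exactly this identification as a HYPOTHESIS STRUCTURE a
supplier must inhabit: `T4ObservableTelescopeTwoRun` v3.1 §6.4 (`ScaleLadder` / `RunLadder`: level maps `ι_{j,j'}`, `j' = j+1`,
between consecutive runs `K' = K+1`, measurable, INTERTWINING the averagings, loop-compatible at the unit level — its question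
(Q-av)) and `T4VarianceMatching` §6 (`NestedFactorisation.nest`: run `K+1`'s first averaging followed by the identification of
its level `1` with run `K`'s level `0`).  This LOW leaf supplies the maps and all the identities; the sibling leaf `T4RunLadder`
(same unit, imports `T4ObservableTelescopeTwoRun`) packages them as the `RunLadder D` / `NestedFactorisation` instances.

## What this file adds (and only this)

§1 THE IDENTIFICATION KIT (no group): `sitesPerDir_eq_of_shift` (`K + j' = K' + j ⇒` equal moduli at `(j+i, j'+i)` for all `i`);
   for a modulus equality `h`, `coordEquiv h` (`ZMod.ringEquivCongr`, preserving `val`, `Nat`/`Int` casts), `siteShift h :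
   Site (F.P K) j ≃ Site (F.P K') j'`, `bondShift h : PBond (F.P K) j ≃ PBond (F.P K') j'`, `stepShift h` on walk steps; proved to
   commute with `Site.shift` / `unshift`, bond targets, the block-centre embedding `emb` and the offsets `offSite` ((0.4)'s
   `x = emb y + n`, two matching level pairs `h₀` at `(j, j')`, `h₁` at `(j+1, j'+1)`), `blockOf`, the unit-lattice labels
   `T4Family.toLevel`, the walks of `T4Continuum` (`walk (siteShift h x) w = (walk x w).map (stepShift h)`) and their endpoints, the
   unit-level loop representatives (`(C.atLevel K).map (stepShift h) = C.atLevel K'`), and to be coherent (`refl`, composition).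
§2 FIELDS: `fieldShift h V := V ∘ bondShift h : GaugeField (F.P K') j' G → GaugeField (F.P K) j G` (any type `G`), coherence,
   inverse, measurability, the measurable equivalence `fieldShiftEquiv`, preservation of the product Haar measure
   (`measurePreserving_fieldShift`, `integral_comp_fieldShift`).
§3 HOLONOMIES AND LOOPS: `holAt (fieldShift h V) γ = holAt V (γ.map (stepShift h))`, hence `loopAt`; at matching UNIT levels
   `loopAt (fieldShift h V) (C.atLevel K) = loopAt V (C.atLevel K')` for every unit-lattice word `C : UWord F` — the `loop` clause of
   `RunLadder` and the `K`-independence of the unit observable `W` of `UnitFactorisation`; compatibility with gauge transformations.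
§4 (0.4): `axialAvg`, the loop variables `BlockAveraging.loopHol`, the small-field guard, `corr`, `avgFun` and
   `(blockAvg ℰ).avg (fieldShift h₀ V) = fieldShift h₁ ((blockAvg ℰ).avg V)` for EVERY small-loop average `ℰ` (`blockAvg_fieldShift`).
§5 (0.12): `stairHol`, `cVar`, `cVarRev`, `seg`, `loopHol₂`, `Small₂`, `corr₂`, `avgFun₂` and `blockAvg₂_fieldShift` for EVERY group
   average `𝓜` and small-loop average `ℰ`.
§6 THE LADDER AND UNIT MAPS ON THE NOSE of the consumers' binders: `ladderShift (hK : K' = K+1) (hj : j' = j+1)` (v3.1's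
   `ScaleLadder.ι j j' hj`), `unitShift K : GaugeField (F.P K) K G → GaugeField (F.P 0) 0 G` (every run's unit lattice read on the
   labels `T4Continuum.USite`), with `loopAt_ladderShift`, `loopAt_unitShift`, `unitShift_ladderShift`, measurability, measure
   preservation, and the (0.4)/(0.12) intertwinings specialised.
§7 THE NAMED HYPOTHESIS `T4Continuum.FiniteEpsData.AvgLevelHomogeneous D` (never asserted; = `ScaleLadder.step` for the canonical
   maps: `(D.av K j).avg ∘ ladderShift = ladderShift ∘ (D.av K' j').avg`, `K' = K+1`, `j' = j+1`), DISCHARGED for every datum whose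
   averagings are `blockAvg ℰ` (`avgLevelHomogeneous_of_blockAvg`) or `blockAvg₂ 𝓜 ℰ` (`…_of_blockAvg₂`) — hence, by unfolding, for
   the apex lineage's `IsBlockAveraged` / `IsBlockAveraged₂` / `IsPrintedAveraged₁/₂` data —, and its consequence for the ITERATED
   averagings: `ladderShift (iter (D.av K') (n+1) U) = iter (D.av K) n (ladderShift ((D.av K' 0).avg U))` (`iter_ladderShift`) and
   `unitShift K' (iter (D.av K') K' U) = unitShift K (iter (D.av K) K (ladderShift ((D.av K' 0).avg U)))` (`unitShift_iter_succ`,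
   the `nest` identity of `NestedFactorisation` in field form).

WHAT IS NOT PROVED / VALUE.  Nothing analytic; no statement about densities, laws, rates or limits; the data type is not changed
(`AvgLevelHomogeneous` is a property a datum may have, proved here for the block-averaged ones).  VALUE = kernel bookkeeping that
closes the interface question (Q-av) for Bałaban's printed averagings; the walls of the telescoping lane (`UniformGeomDefect`,
`LadderGoodBadRate` of `T4ObservableTelescopeTwoRun` — NOT PRINTED for Bałaban's densities) are untouched.  NOT summit progress.

DIVERGENCE (cell row D-t4l.18).  (a) The identification is by EQUALITY OF COORDINATE RINGS (`ZMod n ≃+* ZMod n'` along `n = n'`),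
i.e. label-on-label ("on the nose"), exactly as `T4Continuum` identifies the unit lattices of all runs with `USite`; it is the
identity of point sets of the paper's continuum torus (`T4Continuum.toTorus` is not used: no metric statement is needed).
(b) Everything is specific to the cell's parameter family `T4Family.P K = Missing.params4 L hL m K` (`d = 4` fixed, `L`, `m` shared
by all runs), whose dimension and block size agree across runs by `rfl`; a version for two abstract `Setup.Params` would carry a
cast of `Fin d` in every statement and is not needed by any consumer.

Upstream: `BlockAveragingTwoLevel` (hence `BlockAveraging`, `AveragingRT`, `TorusHypercubicSymmetry`, `T4Covariance`, `T4Continuum`,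
`Setup`).  Consumers (by name, nothing of theirs edited): `T4RunLadder` (this unit), `T4ObservableTelescopeTwoRun` §6.4 (t4-ne1p-p3),
`T4VarianceMatching` §6 (t4-ne7-p3), the apex lineage `T4Apex*`.
-/

noncomputable section

open MeasureTheory

namespace Literature.MathematicalPhysics.QuantumFieldTheory.Balaban1983to89.T4LevelShift

open T4Continuum

/-! ## §1 The identification kit: equal moduli, coordinates, sites, bonds, steps, walks -/

section Kit

variable (F : T4Family)

/-- EQUAL MODULI ALONG A SHIFT: if `K + j' = K' + j` then levels `j + i` of the `K`-th torus and `j' + i` of the `K'`-th torus have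
the same number of sites per direction, `2·L^{m+K−j−i}`, for every `i` ([Balaban1987RG1] (0.1) p. 251 with `ε ↦ L^j ε`: the lattices
`T^{(j)}_{L^j ε}`, as typed by `Setup.Params.sitesPerDir`). [cite: Balaban1987RG1, (0.1) p.251] -/
theorem sitesPerDir_eq_of_shift {K j K' j' : ℕ} (h : K + j' = K' + j) (i : ℕ) :
    (F.P K).sitesPerDir (j + i) = (F.P K').sitesPerDir (j' + i) := by
  simp only [Params.sitesPerDir, T4Family.P_L, T4Family.P_m, T4Family.P_K]
  congr 1
  congr 1
  omega

/-- Consecutive runs, consecutive levels: `|T^{(j)}| = |T'^{(j+1)}|` per direction for `K' = K + 1`, `j' = j + 1`. [folklore] -/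
theorem sitesPerDir_ladder {K K' j j' : ℕ} (hK : K' = K + 1) (hj : j' = j + 1) :
    (F.P K).sitesPerDir j = (F.P K').sitesPerDir j' := by
  have h := sitesPerDir_eq_of_shift F (K := K) (j := j) (K' := K') (j' := j') (by omega) 0
  simpa using h

/-- The unit lattices of all runs have `2·L^m` sites per direction (`T4Continuum.sitesPerDir_top`): run `0` level `0` and run `K`
level `K`. [folklore] -/
theorem sitesPerDir_unit (K : ℕ) : (F.P 0).sitesPerDir 0 = (F.P K).sitesPerDir K := by
  have h := sitesPerDir_eq_of_shift F (K := 0) (j := 0) (K' := K) (j' := K) (by omega) 0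
  simpa using h

variable {F}
variable {K j K' j' : ℕ}

/-- The coordinate rings `ZMod n`, `ZMod n'` along `n = n'`: `ZMod.ringEquivCongr` (as `T4Continuum.siteEquiv`). [folklore] -/
def coordEquiv (h : (F.P K).sitesPerDir j = (F.P K').sitesPerDir j') :
    ZMod ((F.P K).sitesPerDir j) ≃+* ZMod ((F.P K').sitesPerDir j') :=
  ZMod.ringEquivCongr h

/-- `coordEquiv` preserves the canonical representative. [folklore] -/
@[simp] theorem coordEquiv_val (h : (F.P K).sitesPerDir j = (F.P K').sitesPerDir j') (z : ZMod ((F.P K).sitesPerDir j)) :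
    (coordEquiv h z).val = z.val :=
  ZMod.ringEquivCongr_val h z

/-- `coordEquiv` fixes the casts of naturals. [folklore] -/
theorem coordEquiv_natCast (h : (F.P K).sitesPerDir j = (F.P K').sitesPerDir j') (n : ℕ) :
    coordEquiv h (n : ZMod ((F.P K).sitesPerDir j)) = n :=
  map_natCast (coordEquiv h) n

/-- `coordEquiv` fixes the casts of integers. [folklore] -/
theorem coordEquiv_intCast (h : (F.P K).sitesPerDir j = (F.P K').sitesPerDir j') (n : ℤ) :
    coordEquiv h (n : ZMod ((F.P K).sitesPerDir j)) = n :=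
  map_intCast (coordEquiv h) n

/-- **THE LEVEL IDENTIFICATION OF SITES**: level `j` of the `K`-th torus ≃ level `j'` of the `K'`-th torus along equal moduli,
coordinate by coordinate. [cite: Balaban1987RG1, (0.1) p.251] -/
def siteShift (h : (F.P K).sitesPerDir j = (F.P K').sitesPerDir j') : Site (F.P K) j ≃ Site (F.P K') j' where
  toFun x ν := coordEquiv h (x ν)
  invFun y ν := (coordEquiv h).symm (y ν)
  left_inv x := by
    funext ν
    exact (coordEquiv h).symm_apply_apply _
  right_inv y := by
    funext ν
    exact (coordEquiv h).apply_symm_apply _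

/-- [folklore] -/
@[simp] theorem siteShift_apply (h : (F.P K).sitesPerDir j = (F.P K').sitesPerDir j') (x : Site (F.P K) j) (ν : Fin 4) :
    siteShift h x ν = coordEquiv h (x ν) :=
  rfl

/-- `siteShift h x` as a composite of functions (for rewriting under `Function.update`). [folklore] -/
theorem siteShift_eq_comp (h : (F.P K).sitesPerDir j = (F.P K').sitesPerDir j') (x : Site (F.P K) j) :
    (siteShift h x : Site (F.P K') j') = (⇑(coordEquiv h) ∘ x : Fin (F.P K).d → ZMod ((F.P K').sitesPerDir j')) :=
  rfl

/-- The identification commutes with the unit steps `x ↦ x + e_μ`. [folklore] -/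
theorem siteShift_shift (h : (F.P K).sitesPerDir j = (F.P K').sitesPerDir j') (x : Site (F.P K) j) (μ : Fin 4) :
    siteShift h (x.shift μ) = (siteShift h x).shift μ := by
  show (⇑(coordEquiv h) ∘ Function.update x μ (x μ + 1) : Fin (F.P K).d → ZMod ((F.P K').sitesPerDir j')) =
    Function.update (⇑(coordEquiv h) ∘ x) μ (coordEquiv h (x μ) + 1)
  rw [Function.comp_update, map_add, map_one]

/-- The identification commutes with the unit steps `x ↦ x − e_μ`. [folklore] -/
theorem siteShift_unshift (h : (F.P K).sitesPerDir j = (F.P K').sitesPerDir j') (x : Site (F.P K) j) (μ : Fin 4) :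
    siteShift h (x.unshift μ) = (siteShift h x).unshift μ := by
  show (⇑(coordEquiv h) ∘ Function.update x μ (x μ - 1) : Fin (F.P K).d → ZMod ((F.P K').sitesPerDir j')) =
    Function.update (⇑(coordEquiv h) ∘ x) μ (coordEquiv h (x μ) - 1)
  rw [Function.comp_update, map_sub, map_one]

/-- Coherence: along a trivial modulus equality the identification is the identity. [folklore] -/
theorem siteShift_refl (h : (F.P K).sitesPerDir j = (F.P K).sitesPerDir j) (x : Site (F.P K) j) : siteShift h x = x := by
  funext ν
  apply ZMod.val_injective
  simp only [siteShift_apply, coordEquiv_val]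

/-- Coherence: identifications compose. [folklore] -/
theorem siteShift_siteShift {K'' j'' : ℕ} (h : (F.P K).sitesPerDir j = (F.P K').sitesPerDir j')
    (h' : (F.P K').sitesPerDir j' = (F.P K'').sitesPerDir j'') (x : Site (F.P K) j) :
    siteShift h' (siteShift h x) = siteShift (h.trans h') x := by
  funext ν
  apply ZMod.val_injective
  simp only [siteShift_apply, coordEquiv_val]

/-- The identification commutes with the EMBEDDING OF BLOCK CENTRES `emb : T^{(j+1)} → T^{(j)}` (`y ↦ L·y + (L−1)/2`), the two
level pairs `(j, j')` and `(j+1, j'+1)` being matched (`h₀`, `h₁`). [cite: Balaban1987RG1, (0.4) p.253] -/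
theorem siteShift_emb (h₀ : (F.P K).sitesPerDir j = (F.P K').sitesPerDir j')
    (h₁ : (F.P K).sitesPerDir (j + 1) = (F.P K').sitesPerDir (j' + 1)) (y : Site (F.P K) (j + 1)) :
    siteShift h₀ (emb y) = emb (siteShift h₁ y) := by
  funext ν
  simp only [siteShift_apply, emb, coordEquiv_natCast, coordEquiv_val, T4Family.P_L]

/-- The identification commutes with the block points `x = emb y + n` of (0.4)/(0.12) (`T4Continuum.offSite`). [cite: Balaban1987RG1, (0.4) p.253] -/
theorem siteShift_offSite (h₀ : (F.P K).sitesPerDir j = (F.P K').sitesPerDir j')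
    (h₁ : (F.P K).sitesPerDir (j + 1) = (F.P K').sitesPerDir (j' + 1)) (y : Site (F.P K) (j + 1)) (n : Fin (F.P K).d → ℤ) :
    siteShift h₀ (offSite y n) = offSite (siteShift h₁ y) n := by
  funext ν
  simp only [siteShift_apply, offSite, map_add, coordEquiv_intCast]
  rw [← siteShift_apply h₀ (emb y), siteShift_emb h₀ h₁]

/-- The identification commutes with the block map `x ↦ blockOf x` (`⌊x_μ / L⌋`). [cite: Balaban1987RG1, (0.4) p.253] -/
theorem siteShift_blockOf (h₀ : (F.P K).sitesPerDir j = (F.P K').sitesPerDir j')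
    (h₁ : (F.P K).sitesPerDir (j + 1) = (F.P K').sitesPerDir (j' + 1)) (x : Site (F.P K) j) :
    siteShift h₁ (blockOf x) = blockOf (siteShift h₀ x) := by
  funext ν
  simp only [siteShift_apply, blockOf, coordEquiv_natCast, coordEquiv_val, T4Family.P_L]

/-- At the UNIT levels the identification carries the labels `T4Family.toLevel K x` to `toLevel K' x` (`x : USite`): the unit
lattices of all runs are one lattice, `T4Continuum.siteEquiv`. [folklore] -/
theorem siteShift_toLevel {K K' : ℕ} (h : (F.P K).sitesPerDir K = (F.P K').sitesPerDir K') (x : F.USite) :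
    siteShift h (F.toLevel K x) = F.toLevel K' x := by
  funext ν
  apply ZMod.val_injective
  simp only [siteShift_apply, coordEquiv_val, T4Family.toLevel, T4Family.siteEquiv, ZMod.ringEquivCongr_val]

/-- **THE LEVEL IDENTIFICATION OF POSITIVE BONDS** (`⟨x, μ⟩ ↦ ⟨siteShift x, μ⟩`). [folklore] -/
def bondShift (h : (F.P K).sitesPerDir j = (F.P K').sitesPerDir j') : PBond (F.P K) j ≃ PBond (F.P K') j' where
  toFun b := ⟨siteShift h b.src, b.dir⟩
  invFun b := ⟨(siteShift h).symm b.src, b.dir⟩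
  left_inv b := by
    cases b
    simp
  right_inv b := by
    cases b
    simp

/-- [folklore] -/
@[simp] theorem bondShift_src (h : (F.P K).sitesPerDir j = (F.P K').sitesPerDir j') (b : PBond (F.P K) j) :
    (bondShift h b).src = siteShift h b.src :=
  rfl

/-- [folklore] -/
@[simp] theorem bondShift_dir (h : (F.P K).sitesPerDir j = (F.P K').sitesPerDir j') (b : PBond (F.P K) j) :
    (bondShift h b).dir = b.dir :=
  rfl

/-- Bond targets correspond (`siteShift_shift`). [folklore] -/
theorem bondShift_tgt (h : (F.P K).sitesPerDir j = (F.P K').sitesPerDir j') (b : PBond (F.P K) j) :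
    (bondShift h b).tgt = siteShift h b.tgt := by
  show (siteShift h b.src).shift b.dir = siteShift h (b.src.shift b.dir)
  rw [siteShift_shift]

/-- Coherence: bond identifications compose. [folklore] -/
theorem bondShift_bondShift {K'' j'' : ℕ} (h : (F.P K).sitesPerDir j = (F.P K').sitesPerDir j')
    (h' : (F.P K').sitesPerDir j' = (F.P K'').sitesPerDir j'') (b : PBond (F.P K) j) :
    bondShift h' (bondShift h b) = bondShift (h.trans h') b := by
  show (⟨siteShift h' (siteShift h b.src), b.dir⟩ : PBond (F.P K'') j'') = ⟨siteShift (h.trans h') b.src, b.dir⟩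
  rw [siteShift_siteShift]

/-- The identification of walk steps (`T4Continuum.LStep`: a positive bond with an orientation flag). [folklore] -/
def stepShift (h : (F.P K).sitesPerDir j = (F.P K').sitesPerDir j') (s : LStep (F.P K) j) : LStep (F.P K') j' :=
  ⟨bondShift h s.bond, s.fwd⟩

/-- **WALKS CORRESPOND**: the walk spelled by a word from `siteShift h x` is the image of the walk from `x`, step by step. [folklore] -/
theorem walk_siteShift (h : (F.P K).sitesPerDir j = (F.P K').sitesPerDir j') :
    ∀ (x : Site (F.P K) j) (w : List (Letter 4)), walk (siteShift h x) w = (walk x w).map (stepShift h)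
  | _, [] => rfl
  | x, (μ, true) :: w => by
    simp only [walk, List.map_cons]
    rw [← siteShift_shift, walk_siteShift h (x.shift μ) w]
    rfl
  | x, (μ, false) :: w => by
    simp only [walk, List.map_cons]
    rw [← siteShift_unshift, walk_siteShift h (x.unshift μ) w]
    rfl

/-- Walk endpoints correspond. [folklore] -/
theorem walkEnd_siteShift (h : (F.P K).sitesPerDir j = (F.P K').sitesPerDir j') :
    ∀ (x : Site (F.P K) j) (w : List (Letter 4)), walkEnd (siteShift h x) w = siteShift h (walkEnd x w)
  | _, [] => rfl
  | x, (μ, true) :: w => by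
    simp only [walkEnd]
    rw [← siteShift_shift, walkEnd_siteShift h (x.shift μ) w]
  | x, (μ, false) :: w => by
    simp only [walkEnd]
    rw [← siteShift_unshift, walkEnd_siteShift h (x.unshift μ) w]

/-- At matching UNIT levels `(K, K)`, `(K', K')` the level-`K` representative of a unit-lattice word is carried to the
level-`K'` representative: `(C.atLevel K).map (stepShift h) = C.atLevel K'`. [folklore] -/
theorem map_stepShift_atLevel {K K' : ℕ} (h : (F.P K).sitesPerDir K = (F.P K').sitesPerDir K') (C : UWord F) :
    (C.atLevel K).map (stepShift h) = C.atLevel K' := by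
  rw [UWord.atLevel, UWord.atLevel, ← walk_siteShift, siteShift_toLevel]

end Kit

/-! ## §2 Fields: `fieldShift h V = V ∘ bondShift h`, coherence, measurability, Haar -/

section Fields

variable {F : T4Family} {K j K' j' : ℕ} {G : Type*}

/-- **THE LEVEL IDENTIFICATION OF CONFIGURATIONS**: a configuration on level `j'` of the `K'`-th torus read as one on level `j` of
the `K`-th torus, `(fieldShift h V)(b) = V (bondShift h b)`. [cite: Balaban1987RG1, (0.1) p.251] -/
def fieldShift (h : (F.P K).sitesPerDir j = (F.P K').sitesPerDir j') (V : GaugeField (F.P K') j' G) : GaugeField (F.P K) j G :=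
  fun b => V (bondShift h b)

/-- [folklore] -/
@[simp] theorem fieldShift_apply (h : (F.P K).sitesPerDir j = (F.P K').sitesPerDir j') (V : GaugeField (F.P K') j' G)
    (b : PBond (F.P K) j) : fieldShift h V b = V (bondShift h b) :=
  rfl

/-- Coherence: along a trivial modulus equality `fieldShift` is the identity. [folklore] -/
theorem fieldShift_refl (h : (F.P K).sitesPerDir j = (F.P K).sitesPerDir j) (V : GaugeField (F.P K) j G) : fieldShift h V = V := by
  funext b
  show V ⟨siteShift h b.src, b.dir⟩ = V b
  rw [siteShift_refl]

/-- Coherence: `fieldShift h ∘ fieldShift h' = fieldShift (h.trans h')`. [folklore] -/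
theorem fieldShift_fieldShift {K'' j'' : ℕ} (h : (F.P K).sitesPerDir j = (F.P K').sitesPerDir j')
    (h' : (F.P K').sitesPerDir j' = (F.P K'').sitesPerDir j'') (V : GaugeField (F.P K'') j'' G) :
    fieldShift h (fieldShift h' V) = fieldShift (h.trans h') V := by
  funext b
  show V (bondShift h' (bondShift h b)) = V (bondShift (h.trans h') b)
  rw [bondShift_bondShift]

/-- `fieldShift h.symm` is a right inverse of `fieldShift h`. [folklore] -/
theorem fieldShift_symm_fieldShift (h : (F.P K).sitesPerDir j = (F.P K').sitesPerDir j') (V : GaugeField (F.P K) j G) :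
    fieldShift h (fieldShift h.symm V) = V := by
  rw [fieldShift_fieldShift, fieldShift_refl]

/-- `fieldShift h.symm` is a left inverse of `fieldShift h`. [folklore] -/
theorem fieldShift_fieldShift_symm (h : (F.P K).sitesPerDir j = (F.P K').sitesPerDir j') (V : GaugeField (F.P K') j' G) :
    fieldShift h.symm (fieldShift h V) = V := by
  rw [fieldShift_fieldShift, fieldShift_refl]

variable [MeasurableSpace G]

/-- `fieldShift h` is measurable (a reindexing of coordinates). [folklore] -/
theorem measurable_fieldShift (h : (F.P K).sitesPerDir j = (F.P K').sitesPerDir j') :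
    Measurable (fieldShift h : GaugeField (F.P K') j' G → GaugeField (F.P K) j G) :=
  measurable_pi_lambda _ fun _ => measurable_pi_apply _

/-- `fieldShift h` as a measurable equivalence (`MeasurableEquiv.piCongrLeft` along `bondShift h`). [folklore] -/
def fieldShiftEquiv (h : (F.P K).sitesPerDir j = (F.P K').sitesPerDir j') :
    GaugeField (F.P K') j' G ≃ᵐ GaugeField (F.P K) j G :=
  (MeasurableEquiv.piCongrLeft (fun _ : PBond (F.P K') j' => G) (bondShift h)).symm

/-- [folklore] -/
theorem piCongrLeft_bondShift_symm_apply (h : (F.P K).sitesPerDir j = (F.P K').sitesPerDir j') (V : GaugeField (F.P K') j' G) :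
    (MeasurableEquiv.piCongrLeft (fun _ : PBond (F.P K') j' => G) (bondShift h)).symm V = fieldShift h V := by
  funext b
  rfl

/-- [folklore] -/
@[simp] theorem fieldShiftEquiv_apply (h : (F.P K).sitesPerDir j = (F.P K').sitesPerDir j') (V : GaugeField (F.P K') j' G) :
    fieldShiftEquiv (G := G) h V = fieldShift h V :=
  piCongrLeft_bondShift_symm_apply h V

variable [GaugeGroup G] [HaarData G]

/-- **THE IDENTIFICATION PRESERVES THE PRODUCT HAAR MEASURE**: `(fieldShift h)_* dV' = dV` (`Setup.fieldMeasure`). [folklore] -/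
theorem measurePreserving_fieldShift (h : (F.P K).sitesPerDir j = (F.P K').sitesPerDir j') :
    MeasurePreserving (fieldShift h : GaugeField (F.P K') j' G → GaugeField (F.P K) j G)
      (fieldMeasure (F.P K') j' G) (fieldMeasure (F.P K) j G) := by
  haveI : IsProbabilityMeasure (HaarData.haar (G := G)) := HaarData.isProb
  have hm := (measurePreserving_piCongrLeft (fun _ : PBond (F.P K') j' => (HaarData.haar : Measure G)) (bondShift h)).symm _
  have hcoe : ⇑(MeasurableEquiv.piCongrLeft (fun _ : PBond (F.P K') j' => G) (bondShift h)).symm =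
      (fieldShift h : GaugeField (F.P K') j' G → GaugeField (F.P K) j G) :=
    funext (piCongrLeft_bondShift_symm_apply h)
  rw [hcoe] at hm
  exact hm

/-- Change of variables: `∫ g (fieldShift h V) dV' = ∫ g U dU`. [folklore] -/
theorem integral_comp_fieldShift (h : (F.P K).sitesPerDir j = (F.P K').sitesPerDir j') (g : GaugeField (F.P K) j G → ℝ) :
    ∫ V, g (fieldShift h V) ∂fieldMeasure (F.P K') j' G = ∫ U, g U ∂fieldMeasure (F.P K) j G := by
  haveI : IsProbabilityMeasure (HaarData.haar (G := G)) := HaarData.isProb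
  have hm := ((measurePreserving_piCongrLeft (fun _ : PBond (F.P K') j' => (HaarData.haar : Measure G))
    (bondShift h)).symm _).integral_comp' g
  simp_rw [piCongrLeft_bondShift_symm_apply h] at hm
  exact hm

end Fields

/-! ## §3 Holonomies, loop variables at the unit level, gauge transformations -/

section Loops

variable {F : T4Family} {K j K' j' : ℕ} {G : Type*} [GaugeGroup G]

/-- **HOLONOMIES CORRESPOND**: the holonomy of `fieldShift h V` along a walk is the holonomy of `V` along the image walk. [folklore] -/
theorem holAt_fieldShift (h : (F.P K).sitesPerDir j = (F.P K').sitesPerDir j') (V : GaugeField (F.P K') j' G)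
    (γ : List (LStep (F.P K) j)) : holAt (fieldShift h V) γ = holAt V (γ.map (stepShift h)) := by
  simp only [holAt, List.map_map]
  rfl

/-- Loop variables (`T4Continuum.loopAt`) correspond. [folklore] -/
theorem loopAt_fieldShift (h : (F.P K).sitesPerDir j = (F.P K').sitesPerDir j') (V : GaugeField (F.P K') j' G)
    (γ : List (LStep (F.P K) j)) : loopAt (fieldShift h V) γ = loopAt V (γ.map (stepShift h)) := by
  rw [loopAt, loopAt, holAt_fieldShift]

/-- **UNIT-LEVEL LOOP COMPATIBILITY** (the `loop` clause of `T4ObservableTelescopeTwoRun.RunLadder`, for ANY two runs): at matching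
unit levels the loop variable of the word `C` read at level `K` of `fieldShift h V` is its loop variable at level `K'` of `V`. [folklore] -/
theorem loopAt_fieldShift_atLevel {K K' : ℕ} (h : (F.P K).sitesPerDir K = (F.P K').sitesPerDir K')
    (V : GaugeField (F.P K') K' G) (C : UWord F) : loopAt (fieldShift h V) (C.atLevel K) = loopAt V (C.atLevel K') := by
  rw [loopAt_fieldShift, map_stepShift_atLevel]

/-- The identification intertwines the gauge transformations (`u ↦ u ∘ siteShift h`). [folklore] -/
theorem fieldShift_gaugeAct (h : (F.P K).sitesPerDir j = (F.P K').sitesPerDir j') (u : GaugeTransf (F.P K') j' G)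
    (V : GaugeField (F.P K') j' G) :
    fieldShift h (GaugeField.gaugeAct u V) = GaugeField.gaugeAct (fun x => u (siteShift h x)) (fieldShift h V) := by
  funext b
  show u (bondShift h b).src * V (bondShift h b) * (u (bondShift h b).tgt)⁻¹ = _
  rw [bondShift_tgt]
  rfl

end Loops

/-! ## §4 Bałaban's block averaging (0.4) is intertwined: `(blockAvg ℰ).avg ∘ fieldShift h₀ = fieldShift h₁ ∘ (blockAvg ℰ).avg` -/

section BlockAvg

open BlockAveraging

variable {F : T4Family} {K j K' j' : ℕ} {G : Type*} [GaugeGroup G] (ℰ : LoopAverage G)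

omit ℰ in
/-- The straight transporters `U(c)` (`AveragingRT.axialAvg`) correspond. [cite: Balaban1987RG1, (0.4) p.253] -/
theorem axialAvg_fieldShift (h₀ : (F.P K).sitesPerDir j = (F.P K').sitesPerDir j')
    (h₁ : (F.P K).sitesPerDir (j + 1) = (F.P K').sitesPerDir (j' + 1)) (V : GaugeField (F.P K') j' G) (c : PBond (F.P K) (j + 1)) :
    AveragingRT.axialAvg (fieldShift h₀ V) c = AveragingRT.axialAvg V (bondShift h₁ c) := by
  rw [axialAvg_eq_holAt_walk, axialAvg_eq_holAt_walk, holAt_fieldShift, ← walk_siteShift, siteShift_emb h₀ h₁]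
  rfl

omit ℰ in
/-- The loop variables `U(Γ ∪ [x,x′] ∪ (−Γ′) ∪ (−c))` of (0.4) (`BlockAveraging.loopHol`) correspond, index by index. [cite: Balaban1987RG1, (0.4) p.253] -/
theorem loopHol_fieldShift (h₀ : (F.P K).sitesPerDir j = (F.P K').sitesPerDir j')
    (h₁ : (F.P K).sitesPerDir (j + 1) = (F.P K').sitesPerDir (j' + 1)) (V : GaugeField (F.P K') j' G) (c : PBond (F.P K) (j + 1))
    (i : Idx (F.P K)) : loopHol (fieldShift h₀ V) c i = loopHol V (bondShift h₁ c) i := by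
  unfold loopHol
  rw [holAt_fieldShift, ← walk_siteShift, siteShift_emb h₀ h₁]
  rfl

/-- The small-field domain of (0.4) is transported. [folklore] -/
theorem small_fieldShift_iff (h₀ : (F.P K).sitesPerDir j = (F.P K').sitesPerDir j')
    (h₁ : (F.P K).sitesPerDir (j + 1) = (F.P K').sitesPerDir (j' + 1)) (V : GaugeField (F.P K') j' G) (c : PBond (F.P K) (j + 1)) :
    BlockAveraging.Small ℰ (fieldShift h₀ V) c ↔ BlockAveraging.Small ℰ V (bondShift h₁ c) := by
  have hl : loopHol (fieldShift h₀ V) c = loopHol V (bondShift h₁ c) := funext (loopHol_fieldShift h₀ h₁ V c)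
  unfold BlockAveraging.Small
  rw [hl]
  exact Iff.rfl

/-- The correction factor of (0.4) corresponds. [folklore] -/
theorem corr_fieldShift (h₀ : (F.P K).sitesPerDir j = (F.P K').sitesPerDir j')
    (h₁ : (F.P K).sitesPerDir (j + 1) = (F.P K').sitesPerDir (j' + 1)) (V : GaugeField (F.P K') j' G) (c : PBond (F.P K) (j + 1)) :
    corr ℰ (fieldShift h₀ V) c = corr ℰ V (bondShift h₁ c) := by
  have hl : loopHol (fieldShift h₀ V) c = loopHol V (bondShift h₁ c) := funext (loopHol_fieldShift h₀ h₁ V c)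
  unfold corr BlockAveraging.Small
  rw [hl]
  rfl

/-- The total (0.4)-shaped averaging map corresponds: `avgFun ℰ (fieldShift h₀ V) = fieldShift h₁ (avgFun ℰ V)`. [cite: Balaban1987RG1, (0.4) p.253] -/
theorem avgFun_fieldShift (h₀ : (F.P K).sitesPerDir j = (F.P K').sitesPerDir j')
    (h₁ : (F.P K).sitesPerDir (j + 1) = (F.P K').sitesPerDir (j' + 1)) (V : GaugeField (F.P K') j' G) :
    avgFun ℰ (fieldShift h₀ V) = fieldShift h₁ (avgFun ℰ V) := by
  funext c
  show corr ℰ _ c * AveragingRT.axialAvg _ c = corr ℰ V (bondShift h₁ c) * AveragingRT.axialAvg V (bondShift h₁ c)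
  rw [corr_fieldShift ℰ h₀ h₁, axialAvg_fieldShift h₀ h₁]

/-- **BAŁABAN'S BLOCK AVERAGING (0.4) IS LEVEL-HOMOGENEOUS IN THE KERNEL**: for every small-loop average `ℰ` and every pair of
matched level pairs, `(blockAvg ℰ).avg (fieldShift h₀ V) = fieldShift h₁ ((blockAvg ℰ).avg V)`. [cite: Balaban1987RG1, (0.4) p.253] -/
theorem blockAvg_fieldShift (h₀ : (F.P K).sitesPerDir j = (F.P K').sitesPerDir j')
    (h₁ : (F.P K).sitesPerDir (j + 1) = (F.P K').sitesPerDir (j' + 1)) (V : GaugeField (F.P K') j' G) :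
    (blockAvg ℰ).avg (fieldShift h₀ V) = fieldShift h₁ ((blockAvg ℰ).avg V) := by
  simp only [blockAvg_avg]
  exact avgFun_fieldShift ℰ h₀ h₁ V

end BlockAvg

/-! ## §5 Bałaban's two-level averaging (0.12) is intertwined -/

section TwoLevel

open BlockAveraging BlockAveragingTwoLevel

variable {F : T4Family} {K j K' j' : ℕ} {G : Type*} [GaugeGroup G] (𝓜 : GroupAverage G) (ℰ : LoopAverage G)

omit 𝓜 ℰ in
/-- The staircase transporters `U(Γ^σ_{y, y+n})` of (0.11) correspond. [cite: Balaban1987RG1, (0.11) p.253] -/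
theorem stairHol_fieldShift (h₀ : (F.P K).sitesPerDir j = (F.P K').sitesPerDir j')
    (h₁ : (F.P K).sitesPerDir (j + 1) = (F.P K').sitesPerDir (j' + 1)) (V : GaugeField (F.P K') j' G)
    (y : Site (F.P K) (j + 1)) (n : Fin (F.P K).d → ℤ) (σ : Equiv.Perm (Fin (F.P K).d)) :
    stairHol (fieldShift h₀ V) y n σ = stairHol V (siteShift h₁ y) n σ := by
  unfold stairHol
  rw [holAt_fieldShift, ← walk_siteShift, siteShift_emb h₀ h₁]
  rfl

omit ℰ in
/-- The averaged contour variables `U(y, x)` of (0.11) correspond. [cite: Balaban1987RG1, (0.11) p.253] -/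
theorem cVar_fieldShift (h₀ : (F.P K).sitesPerDir j = (F.P K').sitesPerDir j')
    (h₁ : (F.P K).sitesPerDir (j + 1) = (F.P K').sitesPerDir (j' + 1)) (V : GaugeField (F.P K') j' G)
    (y : Site (F.P K) (j + 1)) (n : Fin (F.P K).d → ℤ) :
    cVar 𝓜 (fieldShift h₀ V) y n = cVar 𝓜 V (siteShift h₁ y) n := by
  have h : stairHol (fieldShift h₀ V) y n = stairHol V (siteShift h₁ y) n := funext (stairHol_fieldShift h₀ h₁ V y n)
  unfold cVar
  rw [h]
  rfl

omit ℰ in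
/-- The reversed averaged contour variables `U(x, y)` correspond. [cite: Balaban1987RG1, (0.12) p.254] -/
theorem cVarRev_fieldShift (h₀ : (F.P K).sitesPerDir j = (F.P K').sitesPerDir j')
    (h₁ : (F.P K).sitesPerDir (j + 1) = (F.P K').sitesPerDir (j' + 1)) (V : GaugeField (F.P K') j' G)
    (y : Site (F.P K) (j + 1)) (n : Fin (F.P K).d → ℤ) :
    cVarRev 𝓜 (fieldShift h₀ V) y n = cVarRev 𝓜 V (siteShift h₁ y) n := by
  have h : (fun σ => (stairHol (fieldShift h₀ V) y n σ)⁻¹) = fun σ => (stairHol V (siteShift h₁ y) n σ)⁻¹ :=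
    funext fun σ => by rw [stairHol_fieldShift h₀ h₁]
  unfold cVarRev
  rw [h]
  rfl

omit 𝓜 ℰ in
/-- The parallel-transported segments `U([x, x′])` correspond. [cite: Balaban1987RG1, (0.12) p.254] -/
theorem seg_fieldShift (h₀ : (F.P K).sitesPerDir j = (F.P K').sitesPerDir j')
    (h₁ : (F.P K).sitesPerDir (j + 1) = (F.P K').sitesPerDir (j' + 1)) (V : GaugeField (F.P K') j' G)
    (c : PBond (F.P K) (j + 1)) (n : Fin (F.P K).d → ℤ) :
    seg (fieldShift h₀ V) c n = seg V (bondShift h₁ c) n := by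
  unfold seg
  rw [holAt_fieldShift, ← walk_siteShift, siteShift_offSite h₀ h₁]
  rfl

omit ℰ in
/-- The loop variables `U(c₋, x)U([x, x′])U(x′, c₊)U(−c)` of (0.12) correspond, point by point. [cite: Balaban1987RG1, (0.12) p.254] -/
theorem loopHol₂_fieldShift (h₀ : (F.P K).sitesPerDir j = (F.P K').sitesPerDir j')
    (h₁ : (F.P K).sitesPerDir (j + 1) = (F.P K').sitesPerDir (j' + 1)) (V : GaugeField (F.P K') j' G)
    (c : PBond (F.P K) (j + 1)) (r : Pt (F.P K)) :
    loopHol₂ 𝓜 (fieldShift h₀ V) c r = loopHol₂ 𝓜 V (bondShift h₁ c) r := by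
  unfold loopHol₂
  rw [cVar_fieldShift 𝓜 h₀ h₁, seg_fieldShift h₀ h₁, cVarRev_fieldShift 𝓜 h₀ h₁, axialAvg_fieldShift h₀ h₁, bondShift_tgt]
  rfl

/-- The small-field domain of (0.12) is transported. [folklore] -/
theorem small₂_fieldShift_iff (h₀ : (F.P K).sitesPerDir j = (F.P K').sitesPerDir j')
    (h₁ : (F.P K).sitesPerDir (j + 1) = (F.P K').sitesPerDir (j' + 1)) (V : GaugeField (F.P K') j' G)
    (c : PBond (F.P K) (j + 1)) :
    Small₂ 𝓜 ℰ (fieldShift h₀ V) c ↔ Small₂ 𝓜 ℰ V (bondShift h₁ c) := by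
  unfold Small₂
  refine and_congr (forall_congr' fun r => ?_) (and_congr (forall_congr' fun r => ?_) (forall_congr' fun r => ?_))
  · rw [funext (stairHol_fieldShift h₀ h₁ V c.src (off r))]
    rfl
  · rw [funext (stairHol_fieldShift h₀ h₁ V c.tgt (off r)), bondShift_tgt]
    rfl
  · rw [loopHol₂_fieldShift 𝓜 h₀ h₁]

/-- The correction factor of (0.12) corresponds. [folklore] -/
theorem corr₂_fieldShift (h₀ : (F.P K).sitesPerDir j = (F.P K').sitesPerDir j')
    (h₁ : (F.P K).sitesPerDir (j + 1) = (F.P K').sitesPerDir (j' + 1)) (V : GaugeField (F.P K') j' G)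
    (c : PBond (F.P K) (j + 1)) :
    corr₂ 𝓜 ℰ (fieldShift h₀ V) c = corr₂ 𝓜 ℰ V (bondShift h₁ c) := by
  have hl : loopHol₂ 𝓜 (fieldShift h₀ V) c = loopHol₂ 𝓜 V (bondShift h₁ c) := funext (loopHol₂_fieldShift 𝓜 h₀ h₁ V c)
  unfold corr₂
  rw [hl]
  by_cases hS : Small₂ 𝓜 ℰ V (bondShift h₁ c)
  · rw [if_pos hS, if_pos ((small₂_fieldShift_iff 𝓜 ℰ h₀ h₁ V c).mpr hS)]
    rfl
  · rw [if_neg hS, if_neg (fun h' => hS ((small₂_fieldShift_iff 𝓜 ℰ h₀ h₁ V c).mp h'))]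

/-- The total (0.12)-shaped averaging map corresponds: `avgFun₂ 𝓜 ℰ (fieldShift h₀ V) = fieldShift h₁ (avgFun₂ 𝓜 ℰ V)`. [cite: Balaban1987RG1, (0.12) p.254] -/
theorem avgFun₂_fieldShift (h₀ : (F.P K).sitesPerDir j = (F.P K').sitesPerDir j')
    (h₁ : (F.P K).sitesPerDir (j + 1) = (F.P K').sitesPerDir (j' + 1)) (V : GaugeField (F.P K') j' G) :
    avgFun₂ 𝓜 ℰ (fieldShift h₀ V) = fieldShift h₁ (avgFun₂ 𝓜 ℰ V) := by
  funext c
  show corr₂ 𝓜 ℰ _ c * AveragingRT.axialAvg _ c = corr₂ 𝓜 ℰ V (bondShift h₁ c) * AveragingRT.axialAvg V (bondShift h₁ c)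
  rw [corr₂_fieldShift 𝓜 ℰ h₀ h₁, axialAvg_fieldShift h₀ h₁]

/-- **BAŁABAN'S TWO-LEVEL AVERAGING (0.12) IS LEVEL-HOMOGENEOUS IN THE KERNEL**, for every group average `𝓜` and small-loop average
`ℰ`: `(blockAvg₂ 𝓜 ℰ).avg (fieldShift h₀ V) = fieldShift h₁ ((blockAvg₂ 𝓜 ℰ).avg V)`. [cite: Balaban1987RG1, (0.12) p.254] -/
theorem blockAvg₂_fieldShift (h₀ : (F.P K).sitesPerDir j = (F.P K').sitesPerDir j')
    (h₁ : (F.P K).sitesPerDir (j + 1) = (F.P K').sitesPerDir (j' + 1)) (V : GaugeField (F.P K') j' G) :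
    (blockAvg₂ 𝓜 ℰ).avg (fieldShift h₀ V) = fieldShift h₁ ((blockAvg₂ 𝓜 ℰ).avg V) := by
  simp only [blockAvg₂_avg]
  exact avgFun₂_fieldShift 𝓜 ℰ h₀ h₁ V

end TwoLevel

/-! ## §6 The ladder maps (`K' = K + 1`, `j' = j + 1`) and the unit maps, on the nose of the consumers' binders -/

section Ladder

variable {F : T4Family} {G : Type*}

/-- **THE LADDER IDENTIFICATION** `ι_{j,j'}` between consecutive runs `K' = K + 1` at consecutive levels `j' = j + 1` — the binder
shape of `T4ObservableTelescopeTwoRun.ScaleLadder.ι`: `fieldShift` along `sitesPerDir_ladder`. [folklore] -/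
def ladderShift {K K' : ℕ} (hK : K' = K + 1) {j j' : ℕ} (hj : j' = j + 1) :
    GaugeField (F.P K') j' G → GaugeField (F.P K) j G :=
  fieldShift (sitesPerDir_ladder F hK hj)

/-- [folklore] -/
theorem ladderShift_eq {K K' : ℕ} (hK : K' = K + 1) {j j' : ℕ} (hj : j' = j + 1) :
    (ladderShift hK hj : GaugeField (F.P K') j' G → GaugeField (F.P K) j G) = fieldShift (sitesPerDir_ladder F hK hj) :=
  rfl

/-- **THE UNIT MAP**: the unit-lattice configurations of the `K`-th run read on the labels `USite = Site (F.P 0) 0` (the sites of the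
coarsest run): `fieldShift` along `sitesPerDir_unit`; its site map is `T4Family.toLevel K`. [folklore] -/
def unitShift (K : ℕ) : GaugeField (F.P K) K G → GaugeField (F.P 0) 0 G :=
  fieldShift (sitesPerDir_unit F K)

/-- [folklore] -/
theorem unitShift_eq (K : ℕ) :
    (unitShift K : GaugeField (F.P K) K G → GaugeField (F.P 0) 0 G) = fieldShift (sitesPerDir_unit F K) :=
  rfl

/-- `unitShift 0` is the identity. [folklore] -/
theorem unitShift_zero (V : GaugeField (F.P 0) 0 G) : unitShift 0 V = V :=
  fieldShift_refl _ V

/-- Coherence of the unit maps along the ladder: `unitShift K ∘ ι_{K,K'} = unitShift K'`. [folklore] -/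
theorem unitShift_ladderShift {K K' : ℕ} (hK : K' = K + 1) (V : GaugeField (F.P K') K' G) :
    unitShift K (ladderShift hK hK V) = unitShift K' V :=
  fieldShift_fieldShift _ _ V

section Meas

variable [MeasurableSpace G]

/-- `ladderShift` is measurable (the `measurable_ι` clause of `ScaleLadder`). [folklore] -/
theorem measurable_ladderShift {K K' : ℕ} (hK : K' = K + 1) {j j' : ℕ} (hj : j' = j + 1) :
    Measurable (ladderShift hK hj : GaugeField (F.P K') j' G → GaugeField (F.P K) j G) :=
  measurable_fieldShift _

/-- `unitShift` is measurable. [folklore] -/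
theorem measurable_unitShift (K : ℕ) : Measurable (unitShift K : GaugeField (F.P K) K G → GaugeField (F.P 0) 0 G) :=
  measurable_fieldShift _

variable [GaugeGroup G] [HaarData G]

/-- `ladderShift` preserves the product Haar measures. [folklore] -/
theorem measurePreserving_ladderShift {K K' : ℕ} (hK : K' = K + 1) {j j' : ℕ} (hj : j' = j + 1) :
    MeasurePreserving (ladderShift hK hj : GaugeField (F.P K') j' G → GaugeField (F.P K) j G)
      (fieldMeasure (F.P K') j' G) (fieldMeasure (F.P K) j G) :=
  measurePreserving_fieldShift _

/-- `unitShift` preserves the product Haar measures. [folklore] -/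
theorem measurePreserving_unitShift (K : ℕ) :
    MeasurePreserving (unitShift K : GaugeField (F.P K) K G → GaugeField (F.P 0) 0 G)
      (fieldMeasure (F.P K) K G) (fieldMeasure (F.P 0) 0 G) :=
  measurePreserving_fieldShift _

end Meas

variable [GaugeGroup G]

/-- **UNIT-LEVEL LOOP COMPATIBILITY ALONG THE LADDER** (the `loop` clause of `RunLadder`, on the nose). [folklore] -/
theorem loopAt_ladderShift {K K' : ℕ} (hK : K' = K + 1) (V : GaugeField (F.P K') K' G) (C : UWord F) :
    loopAt (ladderShift hK hK V) (C.atLevel K) = loopAt V (C.atLevel K') :=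
  loopAt_fieldShift_atLevel _ V C

/-- **THE UNIT OBSERVABLE IS RUN-INDEPENDENT**: the loop variable of `C` at the unit level of run `K` is the loop variable of `C` at
level `0` of the configuration read on `USite` (the `W` of a `UnitFactorisation`, `K`-independent). [folklore] -/
theorem loopAt_unitShift (K : ℕ) (V : GaugeField (F.P K) K G) (C : UWord F) :
    loopAt (unitShift K V) (C.atLevel 0) = loopAt V (C.atLevel K) :=
  loopAt_fieldShift_atLevel _ V C

/-- (0.4) along the ladder: `(blockAvg ℰ).avg (ι_{j,j'} V) = ι_{j+1,j'+1} ((blockAvg ℰ).avg V)` — the `step` clause of `ScaleLadder`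
for the (0.4)-shaped averaging, every `ℰ`. [cite: Balaban1987RG1, (0.4) p.253] -/
theorem blockAvg_ladderShift (ℰ : LoopAverage G) {K K' : ℕ} (hK : K' = K + 1) {j j' : ℕ} (hj : j' = j + 1)
    (h₁ : j' + 1 = j + 1 + 1) (V : GaugeField (F.P K') j' G) :
    (BlockAveraging.blockAvg ℰ).avg (ladderShift hK hj V) = ladderShift hK h₁ ((BlockAveraging.blockAvg ℰ).avg V) :=
  blockAvg_fieldShift ℰ _ _ V

/-- (0.12) along the ladder, every `𝓜`, `ℰ`. [cite: Balaban1987RG1, (0.12) p.254] -/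
theorem blockAvg₂_ladderShift (𝓜 : GroupAverage G) (ℰ : LoopAverage G) {K K' : ℕ} (hK : K' = K + 1) {j j' : ℕ}
    (hj : j' = j + 1) (h₁ : j' + 1 = j + 1 + 1) (V : GaugeField (F.P K') j' G) :
    (BlockAveragingTwoLevel.blockAvg₂ 𝓜 ℰ).avg (ladderShift hK hj V) =
      ladderShift hK h₁ ((BlockAveragingTwoLevel.blockAvg₂ 𝓜 ℰ).avg V) :=
  blockAvg₂_fieldShift 𝓜 ℰ _ _ V

end Ladder

end Literature.MathematicalPhysics.QuantumFieldTheory.Balaban1983to89.T4LevelShift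

/-! ## §7 The named hypothesis `AvgLevelHomogeneous`, its discharge for the block-averaged data, and the shifted iteration -/

namespace Literature.MathematicalPhysics.QuantumFieldTheory.Balaban1983to89.T4Continuum.FiniteEpsData

open T4LevelShift

variable {F : T4Family} {G : Type*} [GaugeGroup G] [MeasurableSpace G] [HaarData G]

/-- HYPOTHESIS (named, never asserted): THE AVERAGING PRESCRIPTION IS LEVEL-HOMOGENEOUS — along the canonical identification of
level `j' = j + 1` of run `K' = K + 1` with level `j` of run `K`, the two runs' averaging operations correspond:
`(D.av K j).avg (ι_{j,j'} V) = ι_{j+1,j'+1} ((D.av K' j').avg V)`.  This is the `step` clause of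
`T4ObservableTelescopeTwoRun.ScaleLadder` for the CANONICAL maps `ladderShift` (so that a datum with this property carries a
`RunLadder`, sibling leaf `T4RunLadder`); the cell's data type leaves `av K j` free run by run, so it is a PROPERTY of a datum —
which Bałaban's block averagings have at every level (`avgLevelHomogeneous_of_blockAvg`, `…_of_blockAvg₂` below: in the tree ONE
formula, `blockAvg ℰ` resp. `blockAvg₂ 𝓜 ℰ` transcribing (0.4) resp. (0.12), defines the averaging `T^{(j)} → T^{(j+1)}` for every
`j` and every run). [cite: Balaban1987RG1, (0.4) p.253] -/
def AvgLevelHomogeneous (D : FiniteEpsData F G) : Prop :=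
  ∀ (K K' : ℕ) (hK : K' = K + 1) (j j' : ℕ) (hj : j' = j + 1) (h₁ : j' + 1 = j + 1 + 1) (V : GaugeField (F.P K') j' G),
    (D.av K j).avg (ladderShift hK hj V) = ladderShift hK h₁ ((D.av K' j').avg V)

/-- `AvgLevelHomogeneous` HOLDS for every finite-`ε` approximation whose averaging maps are the (0.4)-shaped block averaging
`blockAvg ℰ`, for EVERY small-loop average `ℰ` (in particular for the apex lineage's `IsBlockAveraged D ℰ` /
`IsPrintedAveraged₁ D` data, which unfold to this hypothesis `h`). [cite: Balaban1987RG1, (0.4) p.253] -/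
theorem avgLevelHomogeneous_of_blockAvg (D : FiniteEpsData F G) (ℰ : LoopAverage G)
    (h : ∀ K j, D.av K j = BlockAveraging.blockAvg ℰ) : D.AvgLevelHomogeneous := by
  intro K K' hK j j' hj h₁ V
  rw [h K j, h K' j']
  exact blockAvg_ladderShift ℰ hK hj h₁ V

/-- `AvgLevelHomogeneous` HOLDS for every approximation averaging by the (0.12)-shaped two-level block averaging `blockAvg₂ 𝓜 ℰ`,
every group average `𝓜` and small-loop average `ℰ` (in particular for `IsBlockAveraged₂ D 𝓜 ℰ` / `IsPrintedAveraged₂ D` data).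
[cite: Balaban1987RG1, (0.12) p.254] -/
theorem avgLevelHomogeneous_of_blockAvg₂ (D : FiniteEpsData F G) (𝓜 : GroupAverage G) (ℰ : LoopAverage G)
    (h : ∀ K j, D.av K j = BlockAveragingTwoLevel.blockAvg₂ 𝓜 ℰ) : D.AvgLevelHomogeneous := by
  intro K K' hK j j' hj h₁ V
  rw [h K j, h K' j']
  exact blockAvg₂_ladderShift 𝓜 ℰ hK hj h₁ V

/-- **THE SHIFTED ITERATION** under `AvgLevelHomogeneous`: `n + 1` averagings of run `K' = K + 1` from its finest level, read on
run `K`, are its FIRST averaging (read on run `K`'s finest level) followed by `n` averagings of run `K`: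
`ι (iter av' (n+1) U) = iter av n (ι (av'_0 U))` — induction on `n`, one `step` per level. [folklore] -/
theorem iter_ladderShift (D : FiniteEpsData F G) (hD : D.AvgLevelHomogeneous) {K K' : ℕ} (hK : K' = K + 1) :
    ∀ (n : ℕ) (U : GaugeField (F.P K') 0 G),
      ladderShift hK rfl (Averaging.iter (D.av K') (n + 1) U) =
        Averaging.iter (D.av K) n (ladderShift hK rfl ((D.av K' 0).avg U))
  | 0, _ => rfl
  | n + 1, U => by
    show ladderShift hK rfl ((D.av K' (n + 1)).avg (Averaging.iter (D.av K') (n + 1) U)) =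
      (D.av K n).avg (Averaging.iter (D.av K) n (ladderShift hK rfl ((D.av K' 0).avg U)))
    rw [← iter_ladderShift D hD hK n U, hD K K' hK n (n + 1) rfl rfl]

/-- **THE `nest` IDENTITY IN FIELD FORM** (`T4VarianceMatching.NestedFactorisation`): under `AvgLevelHomogeneous`, the fully
averaged configuration of run `K' = K + 1` read on `USite` is the fully averaged configuration of run `K` applied to run `K'`'s
once-averaged configuration read on run `K`'s finest lattice. [folklore] -/
theorem unitShift_iter_succ (D : FiniteEpsData F G) (hD : D.AvgLevelHomogeneous) {K K' : ℕ} (hK : K' = K + 1)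
    (U : GaugeField (F.P K') 0 G) :
    unitShift K' (Averaging.iter (D.av K') K' U) =
      unitShift K (Averaging.iter (D.av K) K (ladderShift hK rfl ((D.av K' 0).avg U))) := by
  subst hK
  rw [← iter_ladderShift D hD rfl K U, unitShift_ladderShift]

end Literature.MathematicalPhysics.QuantumFieldTheory.Balaban1983to89.T4Continuum.FiniteEpsData

end
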